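/-
Origin: expansion seat `planner-pub-hodgecm-pv01-g5-0`, handover #4 2026-08-18T07:37:11Z (`HOME/pub-hodgecm-pv01-g5/lean/Pv01g5/EndStateLinks.lean`, md5 f2b11746, 132 lines);
landed by the gen-7 packager in gate run 26 as `HodgeCM/PerL34/EndStateLinks.lean` (import ^import Pv[0-9]+g[0-9]+\.→import HodgeCM.PerL34. ×1).
-/
/-
# The end state in ONE vocabulary: `EndState = prints ∧ HeadlineBundle = prints ∧ DictLeaves`

Origin: DAG-node prover seat `planner-pub-hodgecm-pv01-g5-0` (gen 5 of `pub-hodgecm-pv01`), 2026-08-18, handover #4,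
for gate run 26.  NEW additive leaf under `HodgeCM/PerL34/`.  Imports: `HodgeCM.PerL34.EndStateVerdict` (pv01-g4,
gate run 25; brings `EndStateCensus` with `HeadlineBundle` / `DictLeaves` / `NodeLeaves`) and `Pv01g5.EndStateBinderSep`
(handover #3 of this seat, run 26; import prefix `Pv01g5.` ↦ `HodgeCM.PerL34.` on landing; brings `EndStateShadow`).
Mathlib + the package only; `#print axioms` ⊆ {propext, Classical.choice, Quot.sound}; no placeholders.  Nothing cited,
nothing posited (ABSOLUTE RULE): one-line re-packagings of landed theorems.

Purpose (referee readability).  Two bundlings of the headline `AssemblyRoutes.perL_of_openCharsWeilLeavesCRΔ` are in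
the tree: pv01-g4's `EndStateCensus.HeadlineBundle T Pc` (the SEVEN `T`-dependent record / open binders
`hAlb hbr hQ A12 A34 hch hW`) and this seat's `EndStateShadow.EndState T Pc` (ALL thirteen non-`M` binders).  This file
records, kernel-checked, that they are the same census:

* `endState_iff_prints_headlineBundle : EndState T Pc ↔ EndStatePrints T ∧ HeadlineBundle T Pc` (pure re-packaging;
  `EndStatePrints` = the five PRINT / DESIGN binders N07, N09a, N09b, M38, N12b);
* `EndState.dictLeaves (M)`, `EndState.nodeLeaves (M)`: the end state yields pv01-g4's dictionary leaves and node leaves;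
* `endState_iff_prints_dictLeaves (M) (hcov : T.Fact_coverTheta) : EndState T Pc ↔ EndStatePrints T ∧ DictLeaves T Pc`
  — the EXACT WORTH of the end state: five print/design facts + seven dictionary leaves (`Open_thetaSub`,
  `N19w_genIdentity`, `N19g_core`, the two `ArchCCore` chart statements, `Open_chars`, A6 `Open_thetaWedge ∧ ThetaMeet`),
  modulo the model axioms and the DEFINITIONAL `Fact_coverTheta` (needed only to REBUILD the S1 record from A6);
* `perL_eq`: the headline's PerL read through `EndState` and through `HeadlineBundle` is the same term (`rfl`);
* the single-binder separations of handover #3 in LEAF vocabulary: `drop23_not_core34` (the leaf `N19g_core` on the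
  `(34)` side fails in `(U, T.drop23)` while the prints and the other binders hold), `conj02_not_thetaSub_leaf`.
-/
import Summits.HodgeConjecture.HodgeCM.PerL34.EndStateVerdict
import Summits.HodgeConjecture.HodgeCM.PerL34.EndStateBinderSep

/-! PORT of `HodgeCM/PerL34/EndStateLinks.lean` (HodgeCMPerL run 82) — verbatim mechanical port; provenance in the PORT header line. -/

set_option autoImplicit false

noncomputable section

open HodgeCM.Prior.Perl34File HodgeCM.Prior.Perl34File.Perl34 HodgeCM.PerL34.ArchC

namespace HodgeCM

namespace PerL34

namespace EndStateLinks

open Universe Universe.ThetaModel AssemblyRoutes EndStateShadow EndStateBinderSep EndStateCensus CharSpansFinal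

variable {U : Universe} (T : U.ThetaModel)

/-- The five PRINT / DESIGN binders of the end state: N07 (Hodge–Riemann `(2,0)`), N09a (`Fact_embCover`), N09b
(`Fact_innerEmb`), M38 (`Fact_cmInflation`), N12b (the design constraints `κ`-conj / frame-sign). -/
structure EndStatePrints : Prop where
  h07 : N07_hodgeRiemann20 U
  h09a : N09a_embCover T
  h09b : N09b_innerEmb T
  hM38 : U.Fact_cmInflation
  h12b : N12b_signRecipe T

variable {T}
variable {Pc : ∀ {L : CMField} {ι₁ : L →+* ℂ} (V : HermSpace3 L ι₁) (c : SeesawCtx L),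
  C4a.PointedCore (T.core V c)}

/-- (Ported verbatim from the HodgeCMPerL package; no docstring in the source.) -/
theorem _root_.HodgeCM.PerL34.EndStateShadow.EndState.prints (E : EndState T Pc) : EndStatePrints T := ⟨E.h07, E.h09a, E.h09b, E.hM38, E.h12b⟩

/-- (Ported verbatim from the HodgeCMPerL package; no docstring in the source.) -/
theorem _root_.HodgeCM.PerL34.EndStateShadow.EndState.headlineBundle (E : EndState T Pc) : HeadlineBundle T Pc :=
  ⟨E.hAlb, E.hbr, E.hQ, E.A12, E.A34, E.hch, E.hW⟩

/-- **`EndState` = prints ∧ pv01-g4's `HeadlineBundle`** (re-packaging). -/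
theorem endState_iff_prints_headlineBundle : EndState T Pc ↔ EndStatePrints T ∧ HeadlineBundle T Pc :=
  ⟨fun E => ⟨E.prints, E.headlineBundle⟩,
    fun ⟨P, h⟩ => ⟨P.h07, P.h09a, P.h09b, P.hM38, h.alb, P.h12b, h.bridges, h.qaut, h.arch12, h.arch34, h.chars,
      h.weil⟩⟩

/-- The headline's PerL read through either bundling is the same proof term. -/
theorem perL_eq (M : U.ModelAxioms) (E : EndState T Pc) :
    E.perL M = EndStateCensus.perL_of_headlineBundle M T E.h07 E.h09a E.h09b E.hM38 E.h12b Pc E.headlineBundle :=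
  rfl

/-- The end state yields the seven DICTIONARY LEAVES (pv01-g4 `dictLeaves_of_headlineBundle`; uses `M`, M38). -/
theorem _root_.HodgeCM.PerL34.EndStateShadow.EndState.dictLeaves (M : U.ModelAxioms) (E : EndState T Pc) : DictLeaves T Pc :=
  EndStateCensus.dictLeaves_of_headlineBundle T M E.hM38 Pc E.headlineBundle

/-- … and the six NODE LEAVES (`NodeLeaves T`: N12a, N19w, N19g, N29, N31, N33 as `Open_*` statements). -/
theorem _root_.HodgeCM.PerL34.EndStateShadow.EndState.nodeLeaves (M : U.ModelAxioms) (E : EndState T Pc) : NodeLeaves T :=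
  EndStateCensus.nodeLeaves_of_headlineBundle T M E.hM38 Pc E.headlineBundle

/-- **Rebuilding the end state from prints + dictionary leaves** (pv01-g4 `EndStateVerdict.headlineBundle_of_dictLeaves`,
`C`-free; price: the model axioms and the DEFINITIONAL `Fact_coverTheta`, both for the S1 record only). -/
theorem endState_of_dictLeaves (M : U.ModelAxioms) (P : EndStatePrints T) (hcov : T.Fact_coverTheta)
    (h : DictLeaves T Pc) : EndState T Pc :=
  endState_iff_prints_headlineBundle.mpr
    ⟨P, EndStateVerdict.headlineBundle_of_dictLeaves T M P.h07 P.h09a P.h09b hcov Pc h⟩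

/-- **EXACT WORTH OF THE END STATE**: modulo the model axioms and `Fact_coverTheta`, the thirteen binders of the
headline are equivalent to the five print/design facts plus the seven dictionary leaves. -/
theorem endState_iff_prints_dictLeaves (M : U.ModelAxioms) (hcov : T.Fact_coverTheta) :
    EndState T Pc ↔ EndStatePrints T ∧ DictLeaves T Pc :=
  ⟨fun E => ⟨E.prints, E.dictLeaves M⟩, fun ⟨P, h⟩ => endState_of_dictLeaves M P hcov h⟩

/-- PerL from prints + dictionary leaves needs NEITHER M38 NOR `Fact_coverTheta` (pv01-g4 `perL_of_dictLeaves`: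
those are prices of rebuilding the records, not of PerL). -/
theorem perL_of_prints_dictLeaves (M : U.ModelAxioms) (P : EndStatePrints T) (h : DictLeaves T Pc) : U.PerL :=
  EndStateCensus.perL_of_dictLeaves M T P.h07 P.h09a P.h09b P.h12b Pc h

/-! ## The single-binder separations of `EndStateBinderSep` in leaf vocabulary -/

/-- The prints do not read the theta forms: they pass unchanged to any `T.withTheta Θ`. -/
theorem endStatePrints_withTheta_iff
    (Θ : ∀ {L : CMField} {ι₁ : L →+* ℂ} (V : HermSpace3 L ι₁), SeesawCtx L → Fin 4 →
      ∀ Γ : Level V, Set (U.CohC (U.pms L ι₁ V Γ) 1)) :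
    EndStatePrints (T.withTheta Θ) ↔ EndStatePrints T :=
  ⟨fun ⟨a, b, c, d, e⟩ => ⟨a, b, c, d, e⟩, fun ⟨a, b, c, d, e⟩ => ⟨a, b, c, d, e⟩⟩

/-- In `(U, T.drop23)` (given `M ∧ EndState T Pc`) the `(34)`-side LEAF `N19g_core` fails in some good context —
while the prints, `hAlb`, `hbr`, `A12`, `A34`, `hch`, `hW` hold there (`EndStateBinderSep.separating_qaut`). -/
theorem drop23_not_core34 (M : U.ModelAxioms) (E : EndState T Pc) :
    ¬ (∀ {L : CMField} {ι₁ : L →+* ℂ} (V : HermSpace3 L ι₁) (c : SeesawCtx L), T.drop23.GoodCtx ι₁ c →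
      N19g_core T.drop23 V c (T.drop23.t34 V c) 2 3) :=
  fun h => drop23_not_qautBinder M E ((S5ConservativeQaut.qautBridges_iff_core T.drop23).2 h)

/-- In `(U, T.conj02)` (given `M ∧ EndState T Pc`) the S6 LEAF `Open_thetaSub` fails — while the prints, `hbr`,
`hQ`, `A12`, `A34`, `hch`, `hW` hold there (`EndStateBinderSep.separating_alb`). -/
theorem conj02_not_thetaSub_leaf (M : U.ModelAxioms) (E : EndState T Pc) : ¬ T.conj02.Open_thetaSub :=
  T.conj02_not_thetaSub'' M.pull_hodge E.h12b.1 E.h12b.2 (E.inputs M).thetaSub (E.inputs M).thetaWedge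

/-- The separating models keep the prints (so what fails is a DICTIONARY leaf each time, never a print fact). -/
theorem separating_prints (E : EndState T Pc) : EndStatePrints T.drop23 ∧ EndStatePrints T.conj02 :=
  ⟨(endStatePrints_withTheta_iff _).mpr E.prints, (endStatePrints_withTheta_iff _).mpr E.prints⟩

end EndStateLinks

end PerL34

end HodgeCM

end
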